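import Summits.QuantumFields.GaugeBoot.TiltedLatticeAxisFlip
import Summits.QuantumFields.GaugeBoot.TiltedBoxSiteRP
import Summits.QuantumFields.GaugeBoot.TiltedBox
import HarnessLib

/-!
# Axis flips of the 45°-tilted periodic box and the anti-diagonal mirror `x_i = -x_j` (gauge-boot, L3(υ) supplement)

HONEST FRAMING (cell `pub-gaugeboot`, page 1 of every file): the venture produces certified bounds
on lattice expectations at stated coupling, gauge group, dimension and torus size; NOT a mass gap,
NOT a continuum limit, NOT a string tension; NOT Yang–Mills-summit-bearing (barriers
`FixedCouplingUltralocality`, `PerturbativeInvisibility`).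

Instances of `TiltedLatticeAxisFlip.lean` on the tilted box `TiltedSite d i j M_u M_v L` of
`TiltedBox.lean`, and a fourth reflection-positivity family on the SQUARE tilted box `M_u = M_v`:

* `tiltedFlip m hΓ` — the flip `[x] ↦ [x_m ↦ -x_m]` of the box whenever the tilted lattice `Γ` is
  invariant under it (`hΓ`): along every axis `m ∉ {i, j}` for EVERY period `L`
  (`tiltedLattice_le_comap_negHom` of `TiltedBoxSiteRP.lean`; the site frame there needed `L = 2Q`,
  `Q ≥ 2`), and along the axes `i` and `j` themselves when `M_u = M_v`
  (`tiltedLattice_le_comap_negHom_left/right`: the flip exchanges the two congruences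
  `2M ∣ x_i + x_j`, `2M ∣ x_i - x_j`); `isAxisFlip_tiltedFlip`; the Wilson measure of the box is
  invariant under every such flip (`tiltedBox_integral_comp_flip`, every real `β`; `m`-links
  reversed and inverted). These are symmetries for the SDP reduction, NOT reflections of positive
  type along `i`, `j` (Fröhlich–Israel–Lieb–Simon 1980 §3: the box loses the axis RP in the
  `(i, j)`-plane).
* **`tiltedBox_antiDiagonalRP`** — on the square box `M_u = M_v = M ≥ 2`, reflection positivity in
  the ANTI-DIAGONAL hyperplane `x_i = -x_j`: `0 ≤ ∫ conj F(Θ'U) · F(U) dμ_β` (`β ≥ 0`) for every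
  bounded measurable `F` depending only on the links with both endpoints in
  `{0 ≤ x_i + x_j ≤ M (mod 2M)}`, where `Θ' = Φ_j ∘ Θ ∘ Φ_j` is the diagonal mirror `Θ`
  (`configSwap`, `TiltedBox.lean`) conjugated by the flip `Φ_j` of the axis `j` — on sites
  `x ↦ (x_i, x_j ↦ -x_j, -x_i)`, `i`- and `j`-links exchanged AND reversed (inverted). Proof:
  `μ_β` is `Φ_j`-invariant and `Φ_j` is an involution, so the integral equals
  `∫ conj G(ΘV) G(V) dμ_β` with `G = F ∘ Φ_j`, an observable of the diagonal half
  (`tiltedHeight ∘ flip_j = tiltedSum`), and `tiltedBox_diagonalRP` applies.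

References: J. Fröhlich, R. Israel, E. H. Lieb, B. Simon, J. Stat. Phys. 22 (1980) 297, §3;
V. Kazakov, Z. Zheng, arXiv:2203.11360 §3.1 (the diagonal RP family), §3.3 (symmetries of the bootstrap).
-/

noncomputable section

open MeasureTheory Complex QuotientAddGroup
open scoped ComplexOrder ComplexConjugate

namespace Summit.QuantumFields.GaugeBoot

namespace TiltedRP

/-! ## The flips of the box -/

section Flips

variable (d : ℕ) {i j : Fin d} (Mu Mv L : ℕ)

/-- **The flip `[x] ↦ [x_m ↦ -x_m]` of the tilted box** along an axis `m` under which `Γ` is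
invariant. For `m ∉ {i, j}` this is `tiltedReflect` of `TiltedBoxSiteRP.lean`. -/
def tiltedFlip (m : Fin d)
    (hΓ : tiltedLattice d i j Mu Mv L ≤ (tiltedLattice d i j Mu Mv L).comap (negHom d m)) :
    TiltedSite d i j Mu Mv L →+ TiltedSite d i j Mu Mv L :=
  QuotientAddGroup.map _ _ (negHom d m) hΓ

/-- The flip on classes. -/
theorem tiltedFlip_mk (m : Fin d)
    (hΓ : tiltedLattice d i j Mu Mv L ≤ (tiltedLattice d i j Mu Mv L).comap (negHom d m))
    (x : Fin d → ℤ) :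
    tiltedFlip d Mu Mv L m hΓ (x : TiltedSite d i j Mu Mv L) =
      ((negHom d m x : Fin d → ℤ) : TiltedSite d i j Mu Mv L) := rfl

/-- **Every lattice-preserving coordinate flip of the box is an axis flip** of the periodic lattice
`(TiltedSite, tiltedUnit)`. -/
theorem isAxisFlip_tiltedFlip (m : Fin d)
    (hΓ : tiltedLattice d i j Mu Mv L ≤ (tiltedLattice d i j Mu Mv L).comap (negHom d m)) :
    IsAxisFlip (tiltedUnit d i j Mu Mv L) m (tiltedFlip d Mu Mv L m hΓ) where
  map_e_self := by
    show tiltedFlip d Mu Mv L m hΓ ((Pi.single m (1 : ℤ) : Fin d → ℤ) : TiltedSite d i j Mu Mv L) = _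
    rw [tiltedFlip_mk, negHom_single, if_pos rfl]
    rfl
  map_e_other l hl := by
    show tiltedFlip d Mu Mv L m hΓ ((Pi.single l (1 : ℤ) : Fin d → ℤ) : TiltedSite d i j Mu Mv L) = _
    rw [tiltedFlip_mk, negHom_single, if_neg hl]
    rfl
  invol q := by
    induction q using QuotientAddGroup.induction_on with
    | H x =>
      rw [tiltedFlip_mk, tiltedFlip_mk]
      congr 1
      funext n
      simp only [negHom_apply]
      split_ifs <;> simp

/-- `Γ` of the SQUARE box (`M_u = M_v`) is invariant under `x_i ↦ -x_i` (the two congruences are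
exchanged). -/
theorem tiltedLattice_le_comap_negHom_left {M : ℕ} (hij : i ≠ j) :
    tiltedLattice d i j M M L ≤ (tiltedLattice d i j M M L).comap (negHom d i) := by
  intro x hx
  rw [AddSubgroup.mem_comap, mem_tiltedLattice_iff]
  rw [mem_tiltedLattice_iff] at hx
  obtain ⟨h1, h2, h3⟩ := hx
  have hi : negHom d i x i = -x i := by simp [negHom_apply]
  have hj : negHom d i x j = x j := by simp [negHom_apply, Ne.symm hij]
  have ho : ∀ m, m ≠ i → negHom d i x m = x m := fun m hm => by simp [negHom_apply, hm]
  rw [hi, hj]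
  refine ⟨?_, ?_, fun m hmi hmj => ?_⟩
  · rw [show -x i + x j = -(x i - x j) by ring]; exact h2.neg_right
  · rw [show -x i - x j = -(x i + x j) by ring]; exact h1.neg_right
  · rw [ho m hmi]; exact h3 m hmi hmj

/-- `Γ` of the square box is invariant under `x_j ↦ -x_j`. -/
theorem tiltedLattice_le_comap_negHom_right {M : ℕ} (hij : i ≠ j) :
    tiltedLattice d i j M M L ≤ (tiltedLattice d i j M M L).comap (negHom d j) := by
  intro x hx
  rw [AddSubgroup.mem_comap, mem_tiltedLattice_iff]
  rw [mem_tiltedLattice_iff] at hx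
  obtain ⟨h1, h2, h3⟩ := hx
  have hi : negHom d j x i = x i := by simp [negHom_apply, hij]
  have hj : negHom d j x j = -x j := by simp [negHom_apply]
  have ho : ∀ m, m ≠ j → negHom d j x m = x m := fun m hm => by simp [negHom_apply, hm]
  rw [hi, hj]
  refine ⟨?_, ?_, fun m hmi hmj => ?_⟩
  · rw [← sub_eq_add_neg]; exact h2
  · rw [sub_neg_eq_add]; exact h1
  · rw [ho m hmj]; exact h3 m hmi hmj

end Flips

/-! ## Invariance of the Wilson measure under the flips -/

section Invariance

variable {d : ℕ} {i j : Fin d} {Mu Mv L N : ℕ} [NeZero Mu] [NeZero Mv] [NeZero L]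
variable {G : Type*} [Group G] [TopologicalSpace G] [IsTopologicalGroup G] [CompactSpace G]
  [MeasurableSpace G] [BorelSpace G] [SecondCountableTopology G]
variable (ρ : G →* Matrix (Fin N) (Fin N) ℂ)

/-- **The Wilson measure of the tilted box is invariant under every lattice-preserving coordinate
flip** `x_m ↦ -x_m` (`m`-links reversed and inverted; every real `β`, measurable real `F`): along
`m ∉ {i, j}` for every period `L`, along `i`, `j` when `M_u = M_v`. -/
theorem tiltedBox_integral_comp_flip (m : Fin d)
    (hΓ : tiltedLattice d i j Mu Mv L ≤ (tiltedLattice d i j Mu Mv L).comap (negHom d m))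
    (hρ : Continuous ρ) (β : ℝ) {F : Config (TiltedSite d i j Mu Mv L) d G → ℝ} (hFm : Measurable F) :
    ∫ U, F (configReflect (tiltedUnit d i j Mu Mv L) m (tiltedFlip d Mu Mv L m hΓ) U)
        ∂(gibbs ρ (tiltedUnit d i j Mu Mv L) β) =
      ∫ U, F U ∂(gibbs ρ (tiltedUnit d i j Mu Mv L) β) :=
  (isAxisFlip_tiltedFlip d Mu Mv L m hΓ).integral_comp_configReflect_gibbs ρ hρ β hFm

/-- The same for complex observables. -/
theorem tiltedBox_integral_comp_flip_complex (m : Fin d)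
    (hΓ : tiltedLattice d i j Mu Mv L ≤ (tiltedLattice d i j Mu Mv L).comap (negHom d m))
    (hρ : Continuous ρ) (β : ℝ) {F : Config (TiltedSite d i j Mu Mv L) d G → ℂ} (hFm : Measurable F) :
    ∫ U, F (configReflect (tiltedUnit d i j Mu Mv L) m (tiltedFlip d Mu Mv L m hΓ) U)
        ∂(gibbs ρ (tiltedUnit d i j Mu Mv L) β) =
      ∫ U, F U ∂(gibbs ρ (tiltedUnit d i j Mu Mv L) β) :=
  (isAxisFlip_tiltedFlip d Mu Mv L m hΓ).integral_comp_configReflect_gibbs_complex ρ hρ β hFm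

/-- **The flip along an axis `k ∉ {i, j}` of ANY period**: invariance of the Wilson measure under
`configReflect … k (tiltedReflect …)` of `TiltedBoxSiteRP.lean` without the hypotheses `L = 2Q`,
`Q ≥ 2` of the site frame. -/
theorem tiltedBox_integral_comp_configReflect_anyPeriod {k : Fin d} (hki : k ≠ i) (hkj : k ≠ j)
    (hρ : Continuous ρ) (β : ℝ) {F : Config (TiltedSite d i j Mu Mv L) d G → ℝ} (hFm : Measurable F) :
    ∫ U, F (configReflect (tiltedUnit d i j Mu Mv L) k (tiltedReflect d Mu Mv L hki hkj) U)
        ∂(gibbs ρ (tiltedUnit d i j Mu Mv L) β) =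
      ∫ U, F U ∂(gibbs ρ (tiltedUnit d i j Mu Mv L) β) :=
  tiltedBox_integral_comp_flip ρ k (tiltedLattice_le_comap_negHom d Mu Mv L hki hkj) hρ β hFm

end Invariance

/-! ## The anti-diagonal mirror of the square box -/

section AntiDiagonal

variable (d : ℕ) {i j : Fin d} (M L : ℕ)

/-- **The anti-height of the square box**: `[x] ↦ x_i + x_j mod 2M`. -/
def tiltedSum : TiltedSite d i j M M L →+ ZMod (2 * M) :=
  QuotientAddGroup.lift _ (sumHom d i j M) (by
    intro x hx
    rw [mem_tiltedLattice_iff_cast] at hx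
    rw [AddMonoidHom.mem_ker]
    simpa [sumHom] using hx.1)

/-- The anti-height on classes. -/
theorem tiltedSum_mk (x : Fin d → ℤ) :
    tiltedSum d M L (x : TiltedSite d i j M M L) = ((x i + x j : ℤ) : ZMod (2 * M)) := by
  show sumHom d i j M x = _
  simp [sumHom]

/-- **The flip of the axis `j` carries the height `x_i - x_j` to the anti-height `x_i + x_j`.** -/
theorem tiltedHeight_tiltedFlip (hij : i ≠ j) (q : TiltedSite d i j M M L) :
    tiltedHeight d i j M M L (tiltedFlip d M M L j (tiltedLattice_le_comap_negHom_right d L hij) q) =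
      tiltedSum d M L q := by
  induction q using QuotientAddGroup.induction_on with
  | H x =>
    have hi : negHom d j x i = x i := by simp [negHom_apply, hij]
    have hj : negHom d j x j = -x j := by simp [negHom_apply]
    rw [tiltedFlip_mk, tiltedHeight_mk, tiltedSum_mk, hi, hj, sub_neg_eq_add]

variable {d M L}

/-- **Transport of half-space observables**: if `F` depends only on the links of the anti-diagonal
half `{0 ≤ x_i + x_j ≤ M}`, then `F ∘ Φ_j` depends only on the links of the diagonal half
`{0 ≤ x_i - x_j ≤ M}`. -/
theorem isHalfObservable_comp_flip {G α : Type*} [Group G] (hij : i ≠ j)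
    {F : Config (TiltedSite d i j M M L) d G → α}
    (hFo : IsHalfObservable (tiltedUnit d i j M M L) M (tiltedSum d M L) F) :
    IsHalfObservable (tiltedUnit d i j M M L) M (tiltedHeight d i j M M L)
      (fun U => F (configReflect (tiltedUnit d i j M M L) j
        (tiltedFlip d M M L j (tiltedLattice_le_comap_negHom_right d L hij)) U)) := by
  set φ := tiltedFlip d M M L j (tiltedLattice_le_comap_negHom_right d L hij) with hφ
  have hA := isAxisFlip_tiltedFlip d M M L j (tiltedLattice_le_comap_negHom_right d L hij) (i := i)
  intro U V hUV
  apply hFo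
  intro l hl
  obtain ⟨x, m⟩ := l
  obtain ⟨h1, h2⟩ := hl
  unfold InHalf at h1 h2
  simp only at h1 h2
  by_cases hm : m = j
  · subst hm
    rw [configReflect_self, configReflect_self]
    congr 1
    apply hUV
    refine ⟨?_, ?_⟩ <;> unfold InHalf <;> simp only
    · rw [← hA.map_add_self, tiltedHeight_tiltedFlip d M L hij]
      exact h2
    · rw [sub_add_cancel, tiltedHeight_tiltedFlip d M L hij]
      exact h1
  · rw [configReflect_other _ _ _ _ _ hm, configReflect_other _ _ _ _ _ hm]
    apply hUV
    refine ⟨?_, ?_⟩ <;> unfold InHalf <;> simp only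
    · rw [tiltedHeight_tiltedFlip d M L hij]
      exact h1
    · rw [← hA.map_add_other _ hm, tiltedHeight_tiltedFlip d M L hij]
      exact h2

variable {N : ℕ} [NeZero M] [NeZero L]
variable {G : Type*} [Group G] [TopologicalSpace G] [IsTopologicalGroup G] [CompactSpace G]
  [MeasurableSpace G] [BorelSpace G] [SecondCountableTopology G]
variable (ρ : G →* Matrix (Fin N) (Fin N) ℂ)

/-- **Anti-diagonal reflection positivity of lattice Yang–Mills on the square 45°-tilted periodic
box** (`M_u = M_v = M ≥ 2`, `i ≠ j`, `β ≥ 0`): for every bounded measurable `F` depending only on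
the links with both endpoints in `{0 ≤ x_i + x_j ≤ M (mod 2M)}`,
`0 ≤ ∫ conj F(Θ'U) · F(U) dμ_β(U)` with `Θ' = Φ_j ∘ Θ ∘ Φ_j` the diagonal mirror `Θ` conjugated
by the flip `Φ_j` of the axis `j` (on sites `(x_i, x_j) ↦ (-x_j, -x_i)`; `i`- and `j`-links
exchanged and inverted). -/
theorem tiltedBox_antiDiagonalRP (hij : i ≠ j) (hM : 2 ≤ M) (hρ : Continuous ρ) {β : ℝ} (hβ : 0 ≤ β)
    (F : Config (TiltedSite d i j M M L) d G → ℂ) (hFm : Measurable F)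
    (hFb : ∃ C : ℝ, ∀ U, ‖F U‖ ≤ C)
    (hFo : IsHalfObservable (tiltedUnit d i j M M L) M (tiltedSum d M L) F) :
    0 ≤ ∫ U, conj (F (configReflect (tiltedUnit d i j M M L) j
        (tiltedFlip d M M L j (tiltedLattice_le_comap_negHom_right d L hij))
        (configSwap i j (tiltedMirror d i j M M L)
          (configReflect (tiltedUnit d i j M M L) j
            (tiltedFlip d M M L j (tiltedLattice_le_comap_negHom_right d L hij)) U)))) * F U
      ∂(gibbs ρ (tiltedUnit d i j M M L) β) := by
  set Φ : Config (TiltedSite d i j M M L) d G → Config (TiltedSite d i j M M L) d G :=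
    configReflect (tiltedUnit d i j M M L) j
      (tiltedFlip d M M L j (tiltedLattice_le_comap_negHom_right d L hij)) with hΦ
  set Θ : Config (TiltedSite d i j M M L) d G → Config (TiltedSite d i j M M L) d G :=
    configSwap i j (tiltedMirror d i j M M L) with hΘ
  have hA := isAxisFlip_tiltedFlip d M M L j (tiltedLattice_le_comap_negHom_right d L hij) (i := i)
  have hΦm : Measurable Φ := IsSiteFrame.measurable_configReflect
  have hΘm : Measurable Θ := IsTiltedFrame.measurable_configSwap
  have hΦΦ : ∀ U, Φ (Φ U) = U := fun U => hA.configReflect_configReflect U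
  obtain ⟨CF, hFb⟩ := hFb
  -- `G = F ∘ Φ` is a bounded measurable observable of the diagonal half
  set G' : Config (TiltedSite d i j M M L) d G → ℂ := fun U => F (Φ U) with hG'
  have hGm : Measurable G' := hFm.comp hΦm
  have hGb : ∃ C : ℝ, ∀ U, ‖G' U‖ ≤ C := ⟨CF, fun U => hFb _⟩
  have hGo : IsHalfObservable (tiltedUnit d i j M M L) M (tiltedHeight d i j M M L) G' :=
    isHalfObservable_comp_flip hij hFo
  have key := tiltedBox_diagonalRP (Mu := M) (L := L) ρ hij hM hρ hβ G' hGm hGb hGo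
  -- change of variables `U = Φ V` (`μ_β` is `Φ`-invariant, `Φ` an involution)
  have hint : Measurable fun U => conj (F (Φ (Θ (Φ U)))) * F U :=
    (Complex.continuous_conj.measurable.comp (hFm.comp (hΦm.comp (hΘm.comp hΦm)))).mul hFm
  have hcv := tiltedBox_integral_comp_flip_complex (Mu := M) (Mv := M) (L := L) ρ j
    (tiltedLattice_le_comap_negHom_right d L hij) hρ β hint
  rw [← hcv]
  show 0 ≤ ∫ U, conj (F (Φ (Θ (Φ (Φ U))))) * F (Φ U) ∂(gibbs ρ (tiltedUnit d i j M M L) β)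
  simp only [hΦΦ]
  exact key

end AntiDiagonal

end TiltedRP

end Summit.QuantumFields.GaugeBoot
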